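import Summits.BirchSwinnertonDyer.BirchSwinnertonDyer.Theorems.SylvesterTwoHeegnerIndexCMHalfTransversal
import Summits.BirchSwinnertonDyer.BirchSwinnertonDyer.Theorems.SylvesterTwoHeegnerIndexCMFlipBlockOne
import Summits.BirchSwinnertonDyer.BirchSwinnertonDyer.Theorems.SylvesterTwoHeegnerIndexCMFlipLevelPairPrep
import Summits.BirchSwinnertonDyer.Rank1Residual.X11b.KolyvaginH44ConcreteData
import Literature.NumberTheory.EllipticCurves.RingClassFieldConjugation
import HarnessLib

/-!
# (S4) of leaf (L1) at `p ≡ 7 (mod 9)`, crux `UpperOffV0HSYPlus` (stmt-BirchSwinnertonDyer-19804): THE HALF LEVEL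
# PACKAGE at `9pℓ` — the half `χ_A`-sum of the derived CM point is `Γ_K`-invariant modulo `2`, GRANTED THE TOWER
# FIXING at `n = ℓ`

Skeleton of record VARIANT M (`Cruxes/UpperOffV0HSYPlus/Lines/coupled_variantM.lean` 406ca288e244d392), stub
`stub_layerL1Seven`; planner D507 (4), D510 (label of record: leaf (L1)@7 = g24's architecture on the HALF index set +
ONE displayed cell lemma, TOWER FIXING = memo two §67.2 (W2-b), kept INLINE as explicit binders).  This file supplies
k-ty1 #14's binders `hQN` / `hP₁` for the HALF classes `c′_A(ℓ)`: with the rows' data (coupled frame #R-g, pinned `κ`,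
coherent `emb₀ ⊂ emb`, `N₀ ⊇ N`, `H`, lifts `T`, product representatives `t`), the bottom involution datum (`s ∈ H`,
`s² = 1`, a half `H′`) and THE TOWER FIXING AT `n = ℓ` — an automorphism `φ ∈ Aut_K K[9pℓ]` restricting to `s` on
`K[9p]` with `φ · y_ℓ = y_ℓ` (displayed as the binders `φ / hφs / hφy`; NOT proved, NOT in the tree):

`half_chiComponentA_mem_invPoints`: the half sum `Σ_{(q,h′) ∈ (𝒢₀⧸H) × H′} ρ²_{t(q,h′)}(t(q,h′) • κ⁻¹ ι_e(D_ℓ y_ℓ))`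
lies in `E₉(K̄)^N` and its `ψ_A`-image in `invPoints Γ_K ψ_A(E₉(K̄)^N) 2`.  Proof: the representatives are bijective
onto `Γ_K ⧸ N″` (#S3 `exists_halfFixer`); `D_ℓ y_ℓ` is `N″`-invariant mod `2`: on `N₀` by Gross 3.6 (#R-f
`exists_fixedPoints_zsmul_eq_smul_map_derivOp_sub`), on the coset `N₀φ̃` because a lift `φ̃ ∈ Γ_K` of `φ` FIXES
`D_ℓ y_ℓ` (`φ D_ℓ = D_ℓ φ` in the abelian `Gal(K[9pℓ]/K)`, #F2a `pointGalHom_derivOp_comm`); then k-ty1's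
`JZero.cubicTwist_chiComponent_fixedPoints_mem_invPoints`.

HONEST LABEL: theorems only (no `def`, no `sorry`, no new `Prop`); conditional on the displayed TOWER FIXING binders
(cell lemma W2-b, memo two §67.2, unrefereed); nothing asserted on 19804; no stub closed; X12.CMAtTwo NOT proved; BSD
is not proved by any of this.  `set_option maxHeartbeats 1600000 in` scoped to the one theorem (statement ~50
binders).  `--supports stmt-BirchSwinnertonDyer-19804 --as helper`.
-/

set_option linter.dupNamespace false
set_option autoImplicit false

noncomputable section

open scoped Classical Pointwise

namespace Summit.BirchSwinnertonDyer.BirchSwinnertonDyer.Theorems.SylvesterTwoCMHalf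

open WeierstrassCurve WeierstrassCurve.Affine.Point Field NumberField IsDedekindDomain Finset
open Literature.NumberTheory.EllipticCurves Literature.NumberTheory.GaloisRepresentations
  Literature.NumberTheory.EllipticCurves.ModularForms
  Literature.NumberTheory.EllipticCurves.HuShuYin2019
  Literature.NumberTheory.EllipticCurves.KolyvaginCocycle
  Summit.BirchSwinnertonDyer.BirchSwinnertonDyer.Theorems.SylvesterTwoCMData
  Summit.BirchSwinnertonDyer.BirchSwinnertonDyer.Theorems.SylvesterTwoCMFlip
  Literature.NumberTheory.EllipticCurves.RingClassField
  Summit.BirchSwinnertonDyer.Rank1Residual.X11b Summit.BirchSwinnertonDyer.Rank1Residual.X11b.RingClassTower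

variable {K : Type} [Field K] [NumberField K]

/-! ## §1. Invariance modulo `m` on the half fixer from the dichotomy -/

omit [NumberField K] in
/-- **From `N₀` to `N″` through the dichotomy.**  If every `g ∈ N″` acts on `emb₀ K[9p]` as `1` or as `s`
(`s² = 1`), a lift `φ̃ ∈ Γ_K` of `s` FIXES `P`, and `h • P − P ∈ m·A` for `h ∈ N₀` (the fixer of `emb₀ K[9p]`), then
`h • P − P ∈ m·A` for every `h ∈ N″` (`h = (h φ̃⁻¹) φ̃` with `h φ̃⁻¹ ∈ N₀`). [cite: GrossLMS1991, §4 (4.1)–(4.2)] -/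
theorem exists_mem_zsmul_eq_smul_sub_of_dichotomy {L : Type} [Field L] [Algebra K L]
    (emb₀ : L →+* AlgebraicClosure K) {N₀ N'' : Subgroup (absoluteGaloisGroup K)}
    (hN₀ : ∀ g : absoluteGaloisGroup K, g ∈ N₀ ↔
      ∀ x : L, (show AlgebraicClosure K ≃ₐ[K] AlgebraicClosure K from g) (emb₀ x) = emb₀ x)
    {s : L ≃ₐ[K] L} (hs2 : s * s = 1)
    (hdich : ∀ g ∈ N'', (∀ x : L, (show AlgebraicClosure K ≃ₐ[K] AlgebraicClosure K from g) (emb₀ x) = emb₀ x) ∨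
      (∀ x : L, (show AlgebraicClosure K ≃ₐ[K] AlgebraicClosure K from g) (emb₀ x) = emb₀ (s x)))
    {φt : absoluteGaloisGroup K}
    (hφt₀ : ∀ x : L, (show AlgebraicClosure K ≃ₐ[K] AlgebraicClosure K from φt) (emb₀ x) = emb₀ (s x))
    {M : Type*} [AddCommGroup M] [MulAction (absoluteGaloisGroup K) M] {A : AddSubgroup M} {m : ℤ} {P : M}
    (hφP : φt • P = P) (hP₀ : ∀ h ∈ N₀, ∃ a ∈ A, m • a = h • P - P) :
    ∀ h ∈ N'', ∃ a ∈ A, m • a = h • P - P := by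
  intro h hh
  rcases hdich h hh with h1 | hs
  · exact hP₀ h ((hN₀ h).mpr h1)
  · have hh₀ : h * φt⁻¹ ∈ N₀ := by
      refine (hN₀ _).mpr fun x ↦ ?_
      have e1 : (show AlgebraicClosure K ≃ₐ[K] AlgebraicClosure K from φt⁻¹) (emb₀ x) = emb₀ (s x) := by
        have e := hφt₀ (s x)
        rw [← AlgEquiv.mul_apply, hs2, AlgEquiv.one_apply] at e
        rw [← e]
        exact (show AlgebraicClosure K ≃ₐ[K] AlgebraicClosure K from φt).symm_apply_apply _
      change (show AlgebraicClosure K ≃ₐ[K] AlgebraicClosure K from h)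
        ((show AlgebraicClosure K ≃ₐ[K] AlgebraicClosure K from φt⁻¹) (emb₀ x)) = emb₀ x
      rw [e1, hs, ← AlgEquiv.mul_apply, hs2, AlgEquiv.one_apply]
    obtain ⟨a, ha, hae⟩ := hP₀ _ hh₀
    have hφP' : φt⁻¹ • P = P := by rw [inv_smul_eq_iff, hφP]
    exact ⟨a, ha, by rw [hae, mul_smul, hφP']⟩

/-! ## §1b. A lift of a finite-level automorphism fixing `X` fixes `κ⁻¹ ι_e X` -/

/-- **Transport of a finite-level fixing to `E₉(K̄)`**: if `φ̃ ∈ Γ_K` lifts the automorphism `φ` of `K[n]` along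
`emb` and `φ · X = X` in `W₀(K[n])`, then `φ̃ • κ⁻¹ ι_e X = κ⁻¹ ι_e X` (`κ` equivariant).  The generic-`L` lemma
`smul_embPoints_eq_of_comp` reads `ι_e` with the classical `DecidableEq`; the two readings of `φ · X` agree
definitionally. [cite: GrossLMS1991, §4 (4.2)] [cite: SilvermanAEC2009, VIII.§1] -/
theorem smul_symm_embPoints_eq_of_apply_eq {L : Type} [Field L] [CharZero L] (emb : L →+* AlgebraicClosure K)
    (κ : geomPoints ((cubeSumCurve 9).baseChange K) ≃+
      geomPoints ((⟨0, 0, 1, 0, -1⟩ : WeierstrassCurve ℚ).baseChange K))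
    (hκG : ∀ (g : absoluteGaloisGroup K) (P : geomPoints ((cubeSumCurve 9).baseChange K)),
      κ (g • P) = g • κ P)
    (ιe : letI : DecidableEq L := fun a b ↦ Classical.propDecidable (a = b)
      ((⟨0, 0, 1, 0, -1⟩ : WeierstrassCurve ℚ).baseChange L).toAffine.Point →+
        geomPoints ((⟨0, 0, 1, 0, -1⟩ : WeierstrassCurve ℚ).baseChange K))
    (hιe : ∀ P, ιe P = Affine.Point.map (W' := (⟨0, 0, 1, 0, -1⟩ : WeierstrassCurve ℚ)) emb.toRatAlgHom P)
    (φ : L ≃ₐ[ℚ] L) {φt : absoluteGaloisGroup K}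
    (hφt : ∀ x : L, (show AlgebraicClosure K ≃ₐ[K] AlgebraicClosure K from φt) (emb x) = emb (φ x))
    {X : ((⟨0, 0, 1, 0, -1⟩ : WeierstrassCurve ℚ).baseChange L).toAffine.Point}
    (hX : pointGalHom (⟨0, 0, 1, 0, -1⟩ : WeierstrassCurve ℚ) L φ X = X) :
    φt • κ.symm (ιe X) = κ.symm (ιe X) := by
  have hκs : ∀ (g : absoluteGaloisGroup K) (Q : geomPoints ((⟨0, 0, 1, 0, -1⟩ : WeierstrassCurve ℚ).baseChange K)),
      κ.symm (g • Q) = g • κ.symm Q := fun g Q ↦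
    κ.injective (by rw [hκG, κ.apply_symm_apply, κ.apply_symm_apply])
  have hcomp : ∀ x : L, (show AlgebraicClosure K ≃ₐ[K] AlgebraicClosure K from φt) (emb x) =
      emb (((φ : L ≃ₐ[ℚ] L) : L →+* L) x) := fun x ↦ hφt x
  rw [← hκs, smul_embPoints_eq_of_comp (⟨0, 0, 1, 0, -1⟩ : WeierstrassCurve ℚ) emb ιe hιe φt _ hcomp,
    map_toRatAlgHom_eq_pointGalHom]
  exact congrArg (fun z ↦ κ.symm (ιe z)) hX

/-! ## §2. The HALF `χ_A`-component at the level `9pℓ` is `Γ_K`-invariant modulo `2` -/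

set_option maxHeartbeats 1600000 in
/-- **THE HALF LEVEL PACKAGE at `9pℓ`** (the binders `hQN`, `hP₁` of k-ty1 #14 for the HALF index set).  Data: the
coupled frame (`v_B, v_A, ψ_A, ρ`), the pinned `κ`, coherent embeddings `emb₀ ⊂ emb` of `K[9p] ⊆ K[9pℓ]` with fixers
`N₀ ⊇ N`, `∛3, ∛p ∈ K[9p]`, `H`, lifts `T`, product representatives `t`; the involution datum at the bottom (`s ∈ H`,
`s² = 1`, a half `H′`) AND THE TOWER FIXING AT `n = ℓ` (memo two §67.2 (W2-b); displayed, not proved):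
`φ ∈ Aut_K K[9pℓ]` restricting to `s` on `K[9p]` and FIXING HSY's `y_ℓ`.  Then the half `χ_A`-sum
`Σ_{(q,h′) ∈ (𝒢₀⧸H) × H′} ρ²_{t(q,h′)}(t(q,h′) • κ⁻¹ ι_e(D_ℓ y_ℓ))` lies in `E₉(K̄)^N` and its `ψ_A`-image in
`invPoints Γ_K ψ_A(E₉(K̄)^N) 2`: the representatives are bijective onto `Γ_K ⧸ N″` (`N″` = fixer of `K[9p]^{⟨s⟩}`,
`exists_halfFixer`), and `D_ℓ y_ℓ` is `N″`-invariant mod `2` — on `N₀` by Gross 3.6 (#R-f), on the other coset because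
a lift of `φ` FIXES `D_ℓ y_ℓ` (`φ D_ℓ = D_ℓ φ`). [cite: GrossLMS1991, §3 (3.5)–(3.6), §4 (4.1)–(4.4), Lemma 4.3] -/
theorem half_chiComponentA_mem_invPoints {ω : K} (hω : ω ^ 2 + ω + 1 = 0) (h2 : Module.finrank ℚ K = 2)
    (ι : K →+* ℂ) (Dt : ModularParametrizationData (⟨0, 0, 1, 0, -1⟩ : WeierstrassCurve ℚ) 243)
    {p ℓ : ℕ} (hp : p.Prime) (hp3 : p % 3 = 1)
    (hKol : ℓ.Prime ∧ ¬ ℓ ∣ (cubeSumCurve (3 * (p : ℚ) ^ 2)).conductorNorm ℤ ∧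
      ¬ ℓ ∣ (cubeSumCurve (p : ℚ)).conductorNorm ℤ ∧ ¬ ((ℓ : ℤ) ∣ NumberField.discr K) ∧ ℓ ≠ 2 ∧
      (Ideal.span {(ℓ : 𝓞 K)}).IsPrime ∧
      FrobEqFrobInfty (cubeSumCurve (3 * (p : ℚ) ^ 2)) K 2 ℓ ∧ FrobEqFrobInfty (cubeSumCurve (p : ℚ)) K 2 ℓ)
    (κ : geomPoints ((cubeSumCurve 9).baseChange K) ≃+
      geomPoints ((⟨0, 0, 1, 0, -1⟩ : WeierstrassCurve ℚ).baseChange K))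
    (hκG : ∀ (g : absoluteGaloisGroup K) (P : geomPoints ((cubeSumCurve 9).baseChange K)),
      κ (g • P) = g • κ P)
    {vB vA : AlgebraicClosure K} (hvBc : vB ^ 3 = algebraMap ℚ (AlgebraicClosure K) ((p : ℚ) / 9))
    (hvB : vB ≠ 0)
    (hvAc : vA ^ 3 = algebraMap ℚ (AlgebraicClosure K) ((p : ℚ) ^ 2 / 3)) (hvA0 : vA ≠ 0)
    (hvB3 : ∀ g : absoluteGaloisGroup K,
      ((show AlgebraicClosure K ≃ₐ[K] AlgebraicClosure K from g) vB) ^ 3 = vB ^ 3)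
    (hvA3 : ∀ g : absoluteGaloisGroup K,
      ((show AlgebraicClosure K ≃ₐ[K] AlgebraicClosure K from g) vA) ^ 3 = vA ^ 3)
    {ψA : geomPoints ((cubeSumCurve 9).baseChange K) ≃+
      geomPoints ((cubeSumCurve (3 * (p : ℚ) ^ 2)).baseChange K)}
    {ρ : absoluteGaloisGroup K →
      geomPoints ((cubeSumCurve 9).baseChange K) ≃+ geomPoints ((cubeSumCurve 9).baseChange K)}
    (hρ : ∀ (g : absoluteGaloisGroup K) {x y : AlgebraicClosure K}
        (h : (((cubeSumCurve 9).baseChange K).baseChange (AlgebraicClosure K)).toAffine.Nonsingular x y),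
        ∃ h', ρ g (Affine.Point.some x y h) =
          Affine.Point.some (((show AlgebraicClosure K ≃ₐ[K] AlgebraicClosure K from g) vB / vB) ^ 2 * x)
            y h')
    (hρρ : ∀ (g : absoluteGaloisGroup K) {x y : AlgebraicClosure K}
        (h : (((cubeSumCurve 9).baseChange K).baseChange (AlgebraicClosure K)).toAffine.Nonsingular x y),
        ∃ h', ρ g (ρ g (Affine.Point.some x y h)) =
          Affine.Point.some (((show AlgebraicClosure K ≃ₐ[K] AlgebraicClosure K from g) vA / vA) ^ 2 * x)
            y h')
    (hlawA : ∀ (g : absoluteGaloisGroup K) (P : geomPoints ((cubeSumCurve 9).baseChange K)),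
        g • ψA P = ψA (ρ g (ρ g (g • P))))
    -- the coherent embeddings `emb₀ ⊂ emb`, point map `ι_e`, fixers `N₀ ⊇ N`
    (hle : ringClassField K ι (9 * p) ≤ ringClassField K ι (9 * p * ℓ))
    (emb₀ : ringClassField K ι (9 * p) →+* AlgebraicClosure K)
    (hemb₀ : ∀ k : K, emb₀ (algebraMap K (ringClassField K ι (9 * p)) k) = algebraMap K (AlgebraicClosure K) k)
    (emb : ringClassField K ι (9 * p * ℓ) →+* AlgebraicClosure K)
    (hemb : ∀ k : K, emb (algebraMap K (ringClassField K ι (9 * p * ℓ)) k) =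
      algebraMap K (AlgebraicClosure K) k)
    (hcoh : ∀ x : ringClassField K ι (9 * p), emb (RingClassField.inclusion ι hle x) = emb₀ x)
    (ιe : letI : DecidableEq (ringClassField K ι (9 * p * ℓ)) := fun a b ↦ Classical.propDecidable (a = b)
      ((⟨0, 0, 1, 0, -1⟩ : WeierstrassCurve ℚ).baseChange (ringClassField K ι (9 * p * ℓ))).toAffine.Point →+
        geomPoints ((⟨0, 0, 1, 0, -1⟩ : WeierstrassCurve ℚ).baseChange K))
    (hιe : ∀ P, ιe P = Affine.Point.map (W' := (⟨0, 0, 1, 0, -1⟩ : WeierstrassCurve ℚ)) emb.toRatAlgHom P)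
    (N₀ : Subgroup (absoluteGaloisGroup K))
    (hN₀ : ∀ g : absoluteGaloisGroup K, g ∈ N₀ ↔
      ∀ x : ringClassField K ι (9 * p), (show AlgebraicClosure K ≃ₐ[K] AlgebraicClosure K from g) (emb₀ x) = emb₀ x)
    (N : Subgroup (absoluteGaloisGroup K))
    (hN : ∀ g : absoluteGaloisGroup K, g ∈ N ↔
      ∀ x : ringClassField K ι (9 * p * ℓ),
        (show AlgebraicClosure K ≃ₐ[K] AlgebraicClosure K from g) (emb x) = emb x)
    -- `∛3, ∛p ∈ K[9p]`, `H`, lifts `T`, product representatives `t`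
    {c₃ cp : ringClassField K ι (9 * p)} (hc₃ : c₃ ^ 3 = 3) (hcp : cp ^ 3 = (p : ringClassField K ι (9 * p)))
    (H : Subgroup (ringClassField K ι (9 * p) ≃ₐ[K] ringClassField K ι (9 * p)))
    (hH : ∀ σ, σ ∈ H ↔ σ c₃ = c₃ ∧ σ cp = cp)
    [Fintype ((ringClassField K ι (9 * p) ≃ₐ[K] ringClassField K ι (9 * p)) ⧸ H)] [Fintype H]
    (T : (ringClassField K ι (9 * p) ≃ₐ[K] ringClassField K ι (9 * p)) → absoluteGaloisGroup K)
    (hT : ∀ σ (x : ringClassField K ι (9 * p)),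
      (show AlgebraicClosure K ≃ₐ[K] AlgebraicClosure K from T σ) (emb₀ x) = emb₀ (σ x))
    (t : ((ringClassField K ι (9 * p) ≃ₐ[K] ringClassField K ι (9 * p)) ⧸ H) × H → absoluteGaloisGroup K)
    (ht' : ∀ q h, t (q, h) = T (Quotient.out q) * T (h : _))
    -- the involution datum at the bottom: `s ∈ H`, `s² = 1`, a half `H′`
    (s : H) (hs2 : s * s = 1) (H' : Finset H) (hH' : ∀ h : H, Xor (h ∈ H') (h * s ∈ H'))
    -- the generator `σ_ℓ` and HSY's CM point `y_ℓ`
    {σ : ringClassField K ι (9 * p * ℓ) ≃ₐ[ℚ] ringClassField K ι (9 * p * ℓ)}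
    (hσ : Subgroup.zpowers σ = ringClassGalOver ι (9 * p * ℓ) (9 * p))
    {y : ((⟨0, 0, 1, 0, -1⟩ : WeierstrassCurve ℚ).baseChange (ringClassField K ι (9 * p * ℓ))).toAffine.Point}
    (hy : Affine.Point.map (W' := (⟨0, 0, 1, 0, -1⟩ : WeierstrassCurve ℚ))
        (ringClassField K ι (9 * p * ℓ)).subtype.toRatAlgHom y =
      Dt.φ (heegnerTau ((ℓ : ℤ) ^ 2 * (81 * ((p : ℤ) ^ 2 + 4 * p + 16)),
        (ℓ : ℤ) * (-(9 * (4 * (p : ℤ) ^ 2 + 17 * p + 72))), 4 * (p : ℤ) ^ 2 + 18 * p + 81)))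
    {y₁ : ((⟨0, 0, 1, 0, -1⟩ : WeierstrassCurve ℚ).baseChange (ringClassField K ι (9 * p))).toAffine.Point}
    (hy₁ : Affine.Point.map (W' := (⟨0, 0, 1, 0, -1⟩ : WeierstrassCurve ℚ))
        (ringClassField K ι (9 * p)).subtype.toRatAlgHom y₁ =
      Dt.φ (heegnerTau (81 * ((p : ℤ) ^ 2 + 4 * p + 16), -(9 * (4 * (p : ℤ) ^ 2 + 17 * p + 72)),
        4 * (p : ℤ) ^ 2 + 18 * p + 81)))
    -- THE TOWER FIXING at `n = ℓ` (W2-b; displayed, not proved): a lift `φ` of `s` to `K[9pℓ]` fixing `y_ℓ`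
    (φ : ringClassField K ι (9 * p * ℓ) ≃ₐ[K] ringClassField K ι (9 * p * ℓ))
    (hφs : ∀ x : ringClassField K ι (9 * p),
      φ (RingClassField.inclusion ι hle x) =
        RingClassField.inclusion ι hle ((s : ringClassField K ι (9 * p) ≃ₐ[K] ringClassField K ι (9 * p)) x))
    (hφy : pointGalHom (⟨0, 0, 1, 0, -1⟩ : WeierstrassCurve ℚ) (ringClassField K ι (9 * p * ℓ))
      (φ.restrictScalars ℚ) y = y) :
    (∑ i : ((ringClassField K ι (9 * p) ≃ₐ[K] ringClassField K ι (9 * p)) ⧸ H) × H',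
        ρ (t (i.1, (i.2 : H))) (ρ (t (i.1, (i.2 : H))) (t (i.1, (i.2 : H)) •
          κ.symm (ιe (KolyvaginOperator.derivOp
            (pointGalHom (⟨0, 0, 1, 0, -1⟩ : WeierstrassCurve ℚ) (ringClassField K ι (9 * p * ℓ))) σ ℓ y))))) ∈
      FixedPoints.addSubgroup N (geomPoints ((cubeSumCurve 9).baseChange K)) ∧
    ψA (∑ i : ((ringClassField K ι (9 * p) ≃ₐ[K] ringClassField K ι (9 * p)) ⧸ H) × H',
        ρ (t (i.1, (i.2 : H))) (ρ (t (i.1, (i.2 : H))) (t (i.1, (i.2 : H)) •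
          κ.symm (ιe (KolyvaginOperator.derivOp
            (pointGalHom (⟨0, 0, 1, 0, -1⟩ : WeierstrassCurve ℚ) (ringClassField K ι (9 * p * ℓ))) σ ℓ y))))) ∈
      invPoints (absoluteGaloisGroup K)
        ((FixedPoints.addSubgroup N (geomPoints ((cubeSumCurve 9).baseChange K))).map ψA.toAddMonoidHom)
        ((2 : ℕ) : ℤ) := by
  -- ### basics from the clause
  obtain ⟨hℓ, -, -, hℓdK, hℓ2, hinert, -, hFrobB⟩ := hKol
  obtain ⟨hℓ3, hℓp⟩ := mod_three_eq_two_of_clause hω h2 hp hp3 hℓ hℓdK hFrobB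
  have hK := JZero.isImaginaryQuadratic_of_sq_add_self_add_one hω h2
  have hdK := JZero.discr_eq_neg_three_of_sq_add_self_add_one hω h2
  have hp0 : p ≠ 0 := hp.ne_zero
  have hℓ3' : ℓ ≠ 3 := by rintro rfl; norm_num at hℓ3
  have hℓ_odd : Odd ℓ := hℓ.eq_two_or_odd'.resolve_left hℓ2
  haveI := isElliptic_sylvesterNineMinimal
  haveI := isGloballyMinimal_sylvesterNineMinimal
  have hΔ := not_dvd_minimalDiscriminantInt_sylvesterNineMinimal hℓ hℓ3'
  have hMa : ((2 ^ 1 : ℕ) : ℤ) ∣ (⟨0, 0, 1, 0, -1⟩ : WeierstrassCurve ℚ).LFunction ℓ := by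
    rw [JZero.lFunction_eq_zero_of_j_eq_zero_of_mod_three_eq_two _ j_sylvesterNineMinimal hℓ hℓ3 hℓ2 hΔ]
    exact dvd_zero _
  have hMℓ : 2 ^ 1 ∣ ℓ + 1 := by rw [pow_one]; exact hℓ_odd.add_one.two_dvd
  have hn0 : 9 * p * ℓ ≠ 0 := mul_ne_zero (mul_ne_zero (by norm_num) hp0) hℓ.ne_zero
  haveI := (finiteDimensional_and_isGalois_ringClassField hK ι hn0).1
  haveI := (finiteDimensional_and_isGalois_ringClassField hK ι hn0).2
  haveI hNn : N.Normal := normal_of_mem_iff emb hemb N hN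
  -- ### `N₀` read at the level `9pℓ`, the bottom point `y₀ = incl y₁`
  have hN' := mem_iff_forall_mem_nine_mul ι hle emb₀ emb hcoh hN₀
  set y₀ : ((⟨0, 0, 1, 0, -1⟩ : WeierstrassCurve ℚ).baseChange (ringClassField K ι (9 * p * ℓ))).toAffine.Point :=
    Affine.Point.map (W' := (⟨0, 0, 1, 0, -1⟩ : WeierstrassCurve ℚ))
      ((RingClassField.inclusion ι hle).restrictScalars ℚ) y₁ with hy₀def
  have hy₀ : Affine.Point.map (W' := (⟨0, 0, 1, 0, -1⟩ : WeierstrassCurve ℚ))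
        (ringClassField K ι (9 * p * ℓ)).subtype.toRatAlgHom y₀ =
      Dt.φ (heegnerTau (81 * ((p : ℤ) ^ 2 + 4 * p + 16), -(9 * (4 * (p : ℤ) ^ 2 + 17 * p + 72)),
        4 * (p : ℤ) ^ 2 + 18 * p + 81)) := by
    rw [← hy₁, hy₀def]
    exact RingClassTower.map_toRatAlgHom_map_inclusion (W := (⟨0, 0, 1, 0, -1⟩ : WeierstrassCurve ℚ)) ι hle
      (ringClassField K ι (9 * p * ℓ)).subtype (ringClassField K ι (9 * p)).subtype
      (fun x' ↦ RingClassField.coe_inclusion ι hle x') y₁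
  -- ### the derived point `P_ℓ = κ⁻¹ ι_e(D_ℓ y)` is `N`-fixed and `N₀`-invariant mod `2` (Gross 3.6, #R-f)
  set Pℓ := κ.symm (ιe (KolyvaginOperator.derivOp
    (pointGalHom (⟨0, 0, 1, 0, -1⟩ : WeierstrassCurve ℚ) (ringClassField K ι (9 * p * ℓ))) σ ℓ y)) with hPℓ
  have hPN := map_emb_mem_fixedPoints (⟨0, 0, 1, 0, -1⟩ : WeierstrassCurve ℚ) ι emb ιe hιe N hN
    (KolyvaginOperator.derivOp
      (pointGalHom (⟨0, 0, 1, 0, -1⟩ : WeierstrassCurve ℚ) (ringClassField K ι (9 * p * ℓ))) σ ℓ y)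
  have hPℓN : Pℓ ∈ FixedPoints.addSubgroup N (geomPoints ((cubeSumCurve 9).baseChange K)) :=
    mem_fixedPoints_symm_of_equivariant κ hκG N hPN
  have hPraw := exists_fixedPoints_zsmul_eq_smul_map_derivOp_sub hK hdK ι Dt hp3 hℓ hℓ3 hℓp hinert hMℓ hMa
    hσ hy hy₀ emb hemb ιe hιe N hN N₀ hN'
  have hP₀ : ∀ h ∈ N₀, ∃ a ∈ FixedPoints.addSubgroup N (geomPoints ((cubeSumCurve 9).baseChange K)),
      ((2 : ℕ) : ℤ) • a = h • Pℓ - Pℓ := fun h hh ↦ by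
    have e := exists_fixedPoints_zsmul_eq_symm_of_equivariant κ hκG N (hPraw h hh)
    rwa [pow_one] at e
  -- ### the half fixer `N″` and the half transversal
  obtain ⟨N'', hle'', hdich, -, -, hN''vA, ht''⟩ := exists_halfFixer hω h2 ι hp0 hvBc hvAc emb₀ hemb₀ N₀ hN₀
    hc₃ hcp H hH T hT t ht' s hs2 H' hH'
  -- ### THE TOWER FIXING: a lift `φ̃ ∈ Γ_K` of `φ` restricts to `s` on `K[9p]` and FIXES `P_ℓ`
  obtain ⟨φt, hφt⟩ := exists_lift_algEquiv emb hemb φ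
  have hφt₀ : ∀ x : ringClassField K ι (9 * p),
      (show AlgebraicClosure K ≃ₐ[K] AlgebraicClosure K from φt) (emb₀ x) =
        emb₀ ((s : ringClassField K ι (9 * p) ≃ₐ[K] ringClassField K ι (9 * p)) x) := fun x ↦ by
    rw [← hcoh, hφt, hφs, hcoh]
  have hcommφσ : Commute (φ.restrictScalars ℚ) σ := by
    have hφG : φ.restrictScalars ℚ ∈ ringClassGal ι (9 * p * ℓ) :=
      (mem_ringClassGal_iff_forall_apply_algebraMap ι _ _).mpr fun k ↦ φ.commutes k
    have hσG : σ ∈ ringClassGal ι (9 * p * ℓ) :=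
      ringClassGalOver_le_ringClassGal ι _ _ (hσ ▸ Subgroup.mem_zpowers σ)
    have h := (KolyvaginH44.isMulCommutative_ringClassGal' hK ι (9 * p * ℓ)).is_comm.comm ⟨_, hφG⟩ ⟨_, hσG⟩
    exact congrArg Subtype.val h
  have hfin : pointGalHom (⟨0, 0, 1, 0, -1⟩ : WeierstrassCurve ℚ) (ringClassField K ι (9 * p * ℓ))
      (φ.restrictScalars ℚ) (KolyvaginOperator.derivOp
        (pointGalHom (⟨0, 0, 1, 0, -1⟩ : WeierstrassCurve ℚ) (ringClassField K ι (9 * p * ℓ))) σ ℓ y) =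
      KolyvaginOperator.derivOp
        (pointGalHom (⟨0, 0, 1, 0, -1⟩ : WeierstrassCurve ℚ) (ringClassField K ι (9 * p * ℓ))) σ ℓ y := by
    rw [pointGalHom_derivOp_comm _ hcommφσ, hφy]
  have hφP : φt • Pℓ = Pℓ := smul_symm_embPoints_eq_of_apply_eq emb κ hκG ιe hιe (φ.restrictScalars ℚ) hφt hfin
  have hP'' := exists_mem_zsmul_eq_smul_sub_of_dichotomy emb₀ hN₀
    (by rw [← Subgroup.coe_mul, hs2, Subgroup.coe_one]) hdich hφt₀ hφP hP₀
  -- ### the `ρ ∘ ρ` family and its law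
  have hρρ' : ∀ (g : absoluteGaloisGroup K) {x y : AlgebraicClosure K}
      (h : (((cubeSumCurve 9).baseChange K).baseChange (AlgebraicClosure K)).toAffine.Nonsingular x y),
      ∃ h', (fun g ↦ (ρ g).trans (ρ g)) g (Affine.Point.some x y h) =
        Affine.Point.some (((show AlgebraicClosure K ≃ₐ[K] AlgebraicClosure K from g) vA / vA) ^ 2 * x)
          y h' := fun g x y h ↦ hρρ g h
  have hlawA' : ∀ (g : absoluteGaloisGroup K) (P : geomPoints ((cubeSumCurve 9).baseChange K)),
      g • ψA P = ψA ((fun g ↦ (ρ g).trans (ρ g)) g (g • P)) := fun g P ↦ hlawA g P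
  refine ⟨?_, ?_⟩
  · exact chiComponent_mem (fun g ↦ ((ρ g).trans (ρ g)).toAddMonoidHom)
      (fun g _ ha ↦ JZero.smul_mem_fixedPoints _ N g ha)
      (fun g _ ha ↦ JZero.rho_mem_fixedPoints _ hω hvB hvB3 hρ N g (JZero.rho_mem_fixedPoints _ hω hvB hvB3 hρ N g ha))
      (fun i : ((ringClassField K ι (9 * p) ≃ₐ[K] ringClassField K ι (9 * p)) ⧸ H) × H' ↦ t (i.1, (i.2 : H))) hPℓN
  · exact JZero.cubicTwist_chiComponent_fixedPoints_mem_invPoints hω hvA0 hvA3 hρρ' hlawA' N hN''vA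
      (fun i : ((ringClassField K ι (9 * p) ≃ₐ[K] ringClassField K ι (9 * p)) ⧸ H) × H' ↦ t (i.1, (i.2 : H))) ht''
      hPℓN hP''

end Summit.BirchSwinnertonDyer.BirchSwinnertonDyer.Theorems.SylvesterTwoCMHalf

end
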